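import Summits.Ventures.CertifiedManyBodySolver.Theorems.M3x2EdgeSplitSymReplayBoxCanon
import HarnessLib

/-!
# v0′ (rung V, `SymRungV0core`) — CLOSING TEMPLATE with the CLOSED PARTIAL per (D), exercised end to end on `toyRCert`

(pen hub-lb-sym-plan-1 g3, 2026-08-28; companion of the LAYOUT OF RECORD line, hub-lb STATUS 2026-08-28T14:14:36Z; for the
co-lander hub-lb-sym-eng-4 (crit-1 V121 (2)).  Nothing here is v0′ data: every `def` marked REAL says what the real module puts
there; the term structure, the fact shapes and the closing call are the ones to copy.  Kernel-checked on the toy by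
`decide +kernel`; the real modules use `native_decide` (certifier lane).)

REAL LAYOUT (`Summits/Ventures/CertifiedManyBodySolver/Certificates/SymRungV0core/`):
* `Data/CertS{k}`, `Data/GramRS{k}` — token strings (sym-eng-1 g1); `Data/PBase{k}`, `Data/PG0_{k}`, `Data/PG1_{k}` — the three
  SHIPPED partials (sym-eng-4);
* `Cert.lean` — `def v0K : SymCertR := { toSymCert := decodeSymCertV2 tS, gramR := decodeGramR tR }` + sanity
  (`decodeRestV2 tS = 0`, `decodeGramRRest tR = 0`, `v0K.gramR.length = 85`) + `hwf` + `hbox` (lo hi = (−12,−12) / (12,12));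
* `Rok.lean` — `rok_i : gramROKAtB v0K lo hi i = true`, `i = 0 … 84`, and `hRok` as below with `85`;
* `ShardBase.lean` / `ShardG0.lean` / `ShardG1.lean` — `sh_0`, `sh_1`, `sh_2` against the shipped partials;
* `ShardG2.lean` — the CLOSED partial `PG2c := pscale (-1) (collect (P_base ++ P_G0 ++ P_G1))` and `sh_3` against it;
* `Closing.lean` — `Ps`, `hcount`, `hfin`, the closing term, value / floor corollaries.
`sizes := [26, 29]` (NOT `[26, 29, 30]`: `splitRuns` makes `sizes.length + 1` runs, the last run is the remaining 30 blocks;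
`shardCountRG K c sizes = shardCount K♭ c + (sizes.length + 1) = 1 + 3` when `gramM = []`).  `c` (gramM row-chunk size) is inert
when `gramM = []`; any literal, the same one everywhere.

HONEST FRAMING: a typing template on a toy; no v0′ byte is read here; no bound of record moves; rung V is a −0.8942613
COMPUTATIONAL-grade floor, not stmt-Ventures-22024 (−0.83 met BY VALUE only) nor 21721; no summit or crux statement is proved.
-/

noncomputable section

namespace Summit.Ventures.CertifiedManyBodySolver.Theorems.SymReplay.V0coreTemplate

open Summit.Ventures.CertifiedManyBodySolver.Theorems.SymReplay
open Literature.MathematicalPhysics.QuantumLattice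
open Literature.MathematicalPhysics.QuantumLattice.HubbardWave0
open Literature.MathematicalPhysics.QuantumLattice.ThermodynamicLimit
open Summit.Ventures.CertifiedManyBodySolver.Theorems.WardSlot

/-! ##### `Cert.lean` -/

/-- REAL: `{ toSymCert := decodeSymCertV2 tS, gramR := decodeGramR tR }`. -/
def K : SymCertR := toyRCert
/-- REAL: `((-12 : ℤ), (-12 : ℤ))`. -/
def lo : ℤ × ℤ := minCornerP frame3
/-- REAL: `((12 : ℤ), (12 : ℤ))`. -/
def hi : ℤ × ℤ := maxCornerP frame3
/-- gramM row-chunk size: inert when `gramM = []`. -/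
def c : ℕ := 8
/-- REAL: `[26, 29]` (runs 26 / 29 / 30 of the 85 R-blocks in J 3 LPT order).  Toy: 2 R-blocks, runs 1 / 1. -/
def sizes : List ℕ := [1]

/-- REAL: `by native_decide`. -/
theorem hwf : wellFormed K.expand = true := by decide +kernel
theorem hbox : boxLicence K.frame lo hi = true := by decide +kernel

/-! ##### `Rok.lean` (REAL: 85 facts, `native_decide` each) -/

theorem rok_0 : gramROKAtB K lo hi 0 = true := by decide +kernel
theorem rok_1 : gramROKAtB K lo hi 1 = true := by decide +kernel

/-- REAL: `gramR_all_of_factsB v0K lo hi hbox 85 (by native_decide) ⟨rok_0, …, rok_84, trivial⟩`. -/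
theorem hRok : K.gramR.all (gramBlockROK K.frame) = true :=
  gramR_all_of_factsB K lo hi hbox 2 (by decide +kernel) ⟨rok_0, rok_1, trivial⟩

/-! ##### The SHIPPED partials (REAL: decoded from the `Data/PBase*`, `Data/PG0_*`, `Data/PG1_*` chunk strings — here COMPUTED,
which a real module must never do) -/

def P_base : QPoly := canonNFZB lo hi (shardPolyAtRGFast K c sizes 0)
def P_G0 : QPoly := canonNFZB lo hi (shardPolyAtRGFast K c sizes 1)

/-! ##### `ShardBase.lean`, `ShardG0.lean`, … — one `native_decide` per module (REAL) -/

theorem sh_0 : shardOKRGB K c sizes lo hi 0 P_base = true := by decide +kernel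
theorem sh_1 : shardOKRGB K c sizes lo hi 1 P_G0 = true := by decide +kernel

/-! ##### `ShardG2.lean` (toy: the last group is run 1, shard index 2) — the CLOSED partial per (D): minus the collected sum
of the shipped ones; its fact is checked like any other -/

def PG1c : QPoly := pscale (-1) (collect (P_base ++ P_G0))

theorem sh_2 : shardOKRGB K c sizes lo hi 2 PG1c = true := by decide +kernel

/-! ##### `Closing.lean` -/

def Ps : List QPoly := [P_base, P_G0, PG1c]

/-- REAL: `shardCountRG v0K c [26, 29] = 4`. -/
theorem hcount : shardCountRG K c sizes = Ps.length := by decide +kernel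

/-- The partials sum to zero after the canon (REAL: `native_decide`, ≈ 2 × the shipped term count through the box pipe). -/
theorem hfin : isZero (canonNFZB lo hi Ps.flatten) = true := by decide +kernel

/-- **The closing term** (REAL name e.g. `v0core_energy_ge`; facts `⟨sh_0, sh_1, sh_2, sh_3, trivial⟩`). -/
theorem toy_energy_ge : ((symValueR K : ℚ) : ℝ) ≤ energyDensityTT' 1 0 8 (7 / 8) :=
  energyDensity_ge_of_shardsRGB K hwf hRok c sizes lo hi hbox Ps hcount ⟨sh_0, sh_1, sh_2, trivial⟩ hfin

/-- Value corollary shape (REAL: `symValueR v0K = <exact ℚ>` by `native_decide`, then the numeric floor by `rw`). -/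
theorem toy_value : symValueR K = symValueR toyRCert := rfl

end Summit.Ventures.CertifiedManyBodySolver.Theorems.SymReplay.V0coreTemplate

end
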